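import Summits.Ventures.YMGap.RobustBall.HeatBathConcentration
import Summits.Ventures.YMGap.RobustBall.HeatBathPoincareZdDLR
import HarnessLib

/-!
# Robust ball (Y2) — EXPONENTIAL CONCENTRATION OF LOCAL OBSERVABLES IN EVERY INFINITE-VOLUME GIBBS STATE of strong-coupling `SU(N)` lattice
# Yang–Mills on `ℤ^d`

HONEST FRAMING: venture file of the cell `pub-ymgap` (QuantumFields programme), track ROBUST-BALL, seat rb-p2 (g14); the INFINITE-VOLUME (DLR) companion of
`HeatBathConcentration.lean` (tori) — no torus limit is taken: the Gromov–Milman ∕ Aida–Stroock iteration is run directly in a Gibbs state, fed with g12's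
heat-bath Poincaré inequality of every DLR state (`HeatBathPoincareZdDLR.gibbsVariance_le_of_oneLinkKRModulus`).  LATTICE statements at STRONG COUPLING for
the DLR states `μ ∈ 𝒢(γ)` of the Wilson specification `γ = ymSpecification χ_N (Nβ)` on `ℤ^d` ('t Hooft `β`); Wilson action (class K); nothing about
`β → ∞`, the continuum or Clay.
* `gibbs_variance_exp_half_le` — ABSTRACT (any specification `γ` on a product space, any Gibbs state `μ`): if `Var_μ(e^{c f}) ≤ A ∑_{x∈Δ} ∫∫ (e^{c f(U)} − e^{c f(σ)})²
  γ_{x}(dσ|U) μ(dU)` for every real `c`, and `|f(U) − f(U[x ↦ s])| ≤ δ_x` (`x ∈ Δ`), then `Var_μ(e^{t g/2}) ≤ (2A ∑_{x∈Δ} δ_x²)(t²/4) E_μ e^{t g}` for `g = f − E_μ f`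
  (`|e^a − e^b| ≤ |a − b| max(e^a, e^b)`, properness of the one-site kernels and the DLR equations `μ γ_{x} = μ`);
* ★★★ `gibbs_measureReal_deviation_ge_le` ∕ `…_le_le` — ABSTRACT: under the same hypotheses (`A > 0`, `∑ δ_x² > 0`), `μ{±(f − E_μ f) ≥ r} ≤ e^{2/3} exp(−r/√(2A ∑_{x∈Δ} δ_x²))`;
* `isLipschitzCylinder_exp_mul` — `U ↦ e^{c F(U)}` is a Lipschitz cylinder observable if `F` is one (clamp `F`'s Lipschitz representative to `[−M, M]`);
* ★★★ `gibbs_measureReal_deviation_ge_le_of_oneLinkKRModulus` (∕ `_le_le_…`) — every `SU(N)`, every `d ≥ 1`, KR window `2(d−1)|β| ≤ R`, `OneLinkKRModulus N R K`,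
  `6(d−1)|β|K ≤ c < 1`: for EVERY DLR state `μ`, every Lipschitz cylinder `F` on the links `Δ` with link oscillations `|F(U) − F(U[x ↦ s])| ≤ δ_x` (`∑ δ_x² > 0`)
  and every `r`: `μ{±(F − E_μ F) ≥ r} ≤ e^{2/3} exp(−r / √(2(2(1 − c))⁻¹ ∑_{x∈Δ} δ_x²))`;
* ★★★ `su2_gibbs_measureReal_deviation_ge_le` ∕ `…_le_le` — `SU(2)`, `d = 4`, HYPOTHESIS-FREE on `0 ≤ β_W < 2/9` (tree coupling `β_W/2`): for EVERY DLR state of 4D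
  `SU(2)` lattice Yang–Mills, `μ{±(F − E_μ F) ≥ r} ≤ e^{2/3} exp(−r (2 − 9β_W)^{1/2}/ (√2 ‖δ‖₂))` — e.g. an average of `n` plaquettes (`∑ δ² ≤ 96/n`) deviates from its
  mean by `≥ r` with probability `≤ e^{2/3} exp(−r (2 − 9β_W)^{1/2} n^{1/2}/14)`: a McDiarmid-type inequality of Poincaré (exponential) strength for the
  INFINITE-VOLUME strong-coupling state (unique on this window — `StarUniquenessZd` — but uniqueness is not used).
0 sorry, 0 definitions.  References: M. Gromov, V. Milman, Amer. J. Math. 105 (1983) 843; S. Aida, D. Stroock, Math. Res. Lett. 1 (1994) 75; M. Ledoux, The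
Concentration of Measure Phenomenon (AMS 2001) §3.1; H.-O. Georgii (2011) Rem. 1.24; C. Külske, CMP 239 (2003) 29 (concentration for Gibbs fields).
Everything here is proved. [folklore]
-/

noncomputable section

open MeasureTheory Function Real Finset ProbabilityTheory Filter Topology
open scoped NNReal
open Summit.QuantumFields.YangMills.Theorems.StrongPinningPoincare
open Literature.Probability.LatticeModels Literature.Probability.LatticeModels.DobrushinMetric
open Literature.MathematicalPhysics.QuantumLattice hiding torusNorm
open Literature.MathematicalPhysics.QuantumFieldTheory hiding ZdEdge
open Literature.MathematicalPhysics.QuantumFieldTheory.Balaban1983to89.StrongCouplingDobrushinWindow (OneLinkKRModulus)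

namespace Summit.Ventures.YMGap.RobustBall.HeatBathConcentration

/-! ### The Gromov–Milman ∕ Aida–Stroock route in a Gibbs state of a specification -/

section GibbsState

variable {ι : Type*} [DecidableEq ι] {S : Type*} [MeasurableSpace S] {γ : Specification ι S}

/-- **`Var_μ(e^{t g/2}) ≤ (2A ∑_{x∈Δ} δ_x²)(t²/4) E_μ e^{t g}` IN A GIBBS STATE** (`g = f − E_μ f`): from a heat-bath Poincaré inequality of the Gibbs state `μ`
for the exponentials `e^{c f}` through the one-site kernels `γ_{x}`, `x ∈ Δ`, and per-site oscillations `|f(U) − f(U[x ↦ s])| ≤ δ_x` (`|e^a − e^b| ≤ |a−b| max(e^a,e^b)`,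
`max² ≤ e^{2a} + e^{2b}`, properness and the DLR identity `∫∫ φ(σ) γ_{x}(dσ|U) μ(dU) = ∫ φ dμ`). [folklore] -/
theorem gibbs_variance_exp_half_le (hγ : IsSpecification γ) {μ : Measure (ι → S)} (hμ : IsGibbsMeasure γ μ) {Δ : Finset ι} {A : ℝ} (hA : 0 ≤ A)
    {f : (ι → S) → ℝ} (hf : Measurable f) {M : ℝ} (hM : ∀ U, |f U| ≤ M)
    (hP : ∀ c : ℝ, variance (fun U => Real.exp (c * f U)) μ ≤
      A * ∑ x ∈ Δ, ∫ U, ∫ σ, (Real.exp (c * f U) - Real.exp (c * f σ)) ^ 2 ∂(γ {x} U) ∂μ)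
    (δ : ι → ℝ) (hδ : ∀ x ∈ Δ, ∀ U s, |f U - f (update U x s)| ≤ δ x) (t : ℝ) :
    variance (fun U => Real.exp (t / 2 * (f U - ∫ U', f U' ∂μ))) μ ≤
      (2 * A * ∑ x ∈ Δ, δ x ^ 2) * t ^ 2 / 4 * mgf (fun U => f U - ∫ U', f U' ∂μ) μ t := by
  haveI := hμ.isProbabilityMeasure
  set m : ℝ := ∫ U', f U' ∂μ with hm
  -- reduce to `f`: `e^{t g/2} = e^{−t m/2} e^{t f/2}` and `e^{t g} = e^{−t m} e^{t f}`
  have hred : variance (fun U => Real.exp (t / 2 * (f U - m))) μ = Real.exp (-(t / 2 * m)) ^ 2 * variance (fun U => Real.exp (t / 2 * f U)) μ := by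
    have e : (fun U => Real.exp (t / 2 * (f U - m))) = fun U => Real.exp (-(t / 2 * m)) * Real.exp (t / 2 * f U) := by
      funext U; rw [← Real.exp_add]; ring_nf
    rw [e, variance_const_mul]
  have hmgf : mgf (fun U => f U - m) μ t = Real.exp (-(t * m)) * mgf f μ t := by
    simp only [mgf]
    rw [← integral_const_mul]
    refine integral_congr_ae (ae_of_all _ fun U => ?_)
    show Real.exp (t * (f U - m)) = Real.exp (-(t * m)) * Real.exp (t * f U)
    rw [← Real.exp_add]; ring_nf
  have hbdexp : ∀ (c : ℝ) (U : ι → S), |Real.exp (c * f U)| ≤ Real.exp (|c| * M) := fun c U => by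
    rw [abs_of_pos (Real.exp_pos _), Real.exp_le_exp]
    calc c * f U ≤ |c * f U| := le_abs_self _
      _ = |c| * |f U| := abs_mul _ _
      _ ≤ |c| * M := mul_le_mul_of_nonneg_left (hM U) (abs_nonneg _)
  set F : (ι → S) → ℝ := fun U => Real.exp (t / 2 * f U) with hF
  have hPF := hP (t / 2)
  -- pointwise: `(e^{(t/2) f U} − e^{(t/2) f V})² ≤ (t²/4) δ_x² (e^{t f U} + e^{t f V})` whenever `|f U − f V| ≤ δ_x`
  have habs : ∀ a b : ℝ, |Real.exp a - Real.exp b| ≤ |a - b| * max (Real.exp a) (Real.exp b) := by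
    have key : ∀ {a b : ℝ}, b ≤ a → Real.exp a - Real.exp b ≤ (a - b) * Real.exp a := fun {a b} hab => by
      have h1 : (1 - (a - b)) * Real.exp (a - b) ≤ 1 := by
        have h := Real.add_one_le_exp (-(a - b))
        have h' : Real.exp (-(a - b)) * Real.exp (a - b) = 1 := by rw [← Real.exp_add]; simp
        nlinarith [Real.exp_pos (a - b), Real.exp_pos (-(a - b))]
      have h2 : Real.exp a = Real.exp b * Real.exp (a - b) := by rw [← Real.exp_add]; ring_nf
      rw [h2]
      nlinarith [Real.exp_pos b, Real.exp_pos (a - b)]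
    intro a b
    rcases le_total b a with hab | hab
    · rw [abs_of_nonneg (sub_nonneg.2 (Real.exp_le_exp.2 hab)), abs_of_nonneg (sub_nonneg.2 hab)]
      exact (key hab).trans (mul_le_mul_of_nonneg_left (le_max_left _ _) (sub_nonneg.2 hab))
    · rw [abs_of_nonpos (sub_nonpos.2 (Real.exp_le_exp.2 hab)), abs_of_nonpos (sub_nonpos.2 hab), neg_sub, neg_sub]
      exact (key hab).trans (mul_le_mul_of_nonneg_left (le_max_right _ _) (sub_nonneg.2 hab))
  have hpt : ∀ x ∈ Δ, ∀ (U : ι → S) (s : S), (F U - F (update U x s)) ^ 2 ≤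
      t ^ 2 / 4 * δ x ^ 2 * (Real.exp (t * f U) + Real.exp (t * f (update U x s))) := by
    intro x hx U s
    set a : ℝ := t / 2 * f U with ha
    set b : ℝ := t / 2 * f (update U x s) with hb
    have h1 := habs a b
    have hd : |a - b| ≤ |t| / 2 * δ x := by
      rw [ha, hb, ← mul_sub, abs_mul, abs_div, abs_two]
      exact mul_le_mul_of_nonneg_left (hδ x hx U s) (by positivity)
    have hmax0 : 0 ≤ max (Real.exp a) (Real.exp b) := (Real.exp_pos a).le.trans (le_max_left _ _)
    have hea : Real.exp a ^ 2 = Real.exp (t * f U) := by rw [ha, sq, ← Real.exp_add]; ring_nf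
    have heb : Real.exp b ^ 2 = Real.exp (t * f (update U x s)) := by rw [hb, sq, ← Real.exp_add]; ring_nf
    have hmaxsq : max (Real.exp a) (Real.exp b) ^ 2 ≤ Real.exp (t * f U) + Real.exp (t * f (update U x s)) := by
      rcases le_total (Real.exp a) (Real.exp b) with h | h
      · rw [max_eq_right h, heb]; linarith [Real.exp_pos (t * f U)]
      · rw [max_eq_left h, hea]; linarith [Real.exp_pos (t * f (update U x s))]
    calc (F U - F (update U x s)) ^ 2 = |Real.exp a - Real.exp b| ^ 2 := (sq_abs _).symm
      _ ≤ (|a - b| * max (Real.exp a) (Real.exp b)) ^ 2 := pow_le_pow_left₀ (abs_nonneg _) h1 2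
      _ ≤ (|t| / 2 * δ x * max (Real.exp a) (Real.exp b)) ^ 2 :=
          pow_le_pow_left₀ (mul_nonneg (abs_nonneg _) hmax0) (mul_le_mul_of_nonneg_right hd hmax0) 2
      _ = t ^ 2 / 4 * δ x ^ 2 * max (Real.exp a) (Real.exp b) ^ 2 := by rw [mul_pow, mul_pow, div_pow, sq_abs]; ring
      _ ≤ t ^ 2 / 4 * δ x ^ 2 * (Real.exp (t * f U) + Real.exp (t * f (update U x s))) :=
          mul_le_mul_of_nonneg_left hmaxsq (by positivity)
  -- the one-site step: properness turns `σ` into `U[x ↦ s]`, then integrate the pointwise bound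
  have hm1 : Measurable fun U => Real.exp (t * f U) := (hf.const_mul t).exp
  have hb1 : ∀ U, |Real.exp (t * f U)| ≤ Real.exp (|t| * M) := fun U => hbdexp t U
  have hFm : Measurable F := (hf.const_mul _).exp
  have hinner : ∀ x ∈ Δ, ∀ U, ∫ σ, (F U - F σ) ^ 2 ∂(γ {x} U) ≤
      t ^ 2 / 4 * δ x ^ 2 * (Real.exp (t * f U) + siteAvg γ x (fun σ => Real.exp (t * f σ)) U) := by
    intro x hx U
    haveI := isProbabilityMeasure_siteLaw hγ x U
    rw [show (∫ σ, (F U - F σ) ^ 2 ∂(γ {x} U)) = siteAvg γ x (fun σ => (F U - F σ) ^ 2) U from rfl,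
      siteAvg_eq_integral_siteLaw hγ x (f := fun σ => (F U - F σ) ^ 2) ((measurable_const.sub hFm).pow_const 2) U,
      siteAvg_eq_integral_siteLaw hγ x (f := fun σ => Real.exp (t * f σ)) hm1 U]
    have hgi : Integrable (fun s => Real.exp (t * f (update U x s))) (siteLaw γ x U) :=
      HeatBath.integrable_of_abs_le (hm1.comp (measurable_update U)) fun s => hb1 _
    calc ∫ s, (F U - F (update U x s)) ^ 2 ∂(siteLaw γ x U)
        ≤ ∫ s, t ^ 2 / 4 * δ x ^ 2 * (Real.exp (t * f U) + Real.exp (t * f (update U x s))) ∂(siteLaw γ x U) :=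
          integral_mono_of_nonneg (ae_of_all _ fun s => sq_nonneg _) (((integrable_const _).add hgi).const_mul _) (ae_of_all _ fun s => hpt x hx U s)
      _ = t ^ 2 / 4 * δ x ^ 2 * (Real.exp (t * f U) + ∫ s, Real.exp (t * f (update U x s)) ∂(siteLaw γ x U)) := by
          rw [integral_const_mul, integral_add (integrable_const _) hgi]
          simp [integral_const, probReal_univ]
  -- integrate against `μ`; the DLR equations evaluate the resampled term
  have houter : ∀ x ∈ Δ, ∫ U, ∫ σ, (F U - F σ) ^ 2 ∂(γ {x} U) ∂μ ≤ t ^ 2 / 4 * δ x ^ 2 * (mgf f μ t + mgf f μ t) := by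
    intro x hx
    have hPim : Measurable (siteAvg γ x fun σ => Real.exp (t * f σ)) := measurable_siteAvg hγ x hm1
    have hPib : ∀ U, |siteAvg γ x (fun σ => Real.exp (t * f σ)) U| ≤ Real.exp (|t| * M) := fun U => abs_siteAvg_le hγ x hb1 U
    have i1 : Integrable (fun U => Real.exp (t * f U)) μ := HeatBath.integrable_of_abs_le hm1 hb1
    have i2 : Integrable (siteAvg γ x fun σ => Real.exp (t * f σ)) μ := HeatBath.integrable_of_abs_le hPim hPib
    have hup : Integrable (fun U => t ^ 2 / 4 * δ x ^ 2 * (Real.exp (t * f U) + siteAvg γ x (fun σ => Real.exp (t * f σ)) U)) μ :=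
      (i1.add i2).const_mul _
    have hDLR : ∫ U, siteAvg γ x (fun σ => Real.exp (t * f σ)) U ∂μ = mgf f μ t := by
      have e := hμ.setIntegral_integral_spec hγ {x} (B := Set.univ) MeasurableSet.univ hm1 hb1
      simp only [Measure.restrict_univ] at e
      exact e
    calc ∫ U, ∫ σ, (F U - F σ) ^ 2 ∂(γ {x} U) ∂μ
        ≤ ∫ U, t ^ 2 / 4 * δ x ^ 2 * (Real.exp (t * f U) + siteAvg γ x (fun σ => Real.exp (t * f σ)) U) ∂μ :=
          integral_mono_of_nonneg (ae_of_all _ fun U => integral_nonneg fun σ => sq_nonneg _) hup (ae_of_all _ fun U => hinner x hx U)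
      _ = t ^ 2 / 4 * δ x ^ 2 * (mgf f μ t + mgf f μ t) := by
          rw [integral_const_mul, integral_add i1 i2, hDLR]
          rfl
  have hsum : ∑ x ∈ Δ, ∫ U, ∫ σ, (F U - F σ) ^ 2 ∂(γ {x} U) ∂μ ≤ ∑ x ∈ Δ, t ^ 2 / 4 * δ x ^ 2 * (mgf f μ t + mgf f μ t) :=
    Finset.sum_le_sum fun x hx => houter x hx
  have e : ∑ x ∈ Δ, t ^ 2 / 4 * δ x ^ 2 * (mgf f μ t + mgf f μ t) = (2 * ∑ x ∈ Δ, δ x ^ 2) * t ^ 2 / 4 * mgf f μ t := by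
    rw [Finset.mul_sum, Finset.sum_mul, Finset.sum_div, Finset.sum_mul]
    exact Finset.sum_congr rfl fun i _ => by ring
  have hVF : variance F μ ≤ (2 * A * ∑ x ∈ Δ, δ x ^ 2) * t ^ 2 / 4 * mgf f μ t :=
    calc variance F μ ≤ A * ∑ x ∈ Δ, ∫ U, ∫ σ, (F U - F σ) ^ 2 ∂(γ {x} U) ∂μ := by
          have h := hPF
          have e2 : (fun U => Real.exp (t / 2 * f U)) = F := rfl
          rw [e2] at h
          exact h
      _ ≤ A * ((2 * ∑ x ∈ Δ, δ x ^ 2) * t ^ 2 / 4 * mgf f μ t) := mul_le_mul_of_nonneg_left (hsum.trans e.le) hA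
      _ = (2 * A * ∑ x ∈ Δ, δ x ^ 2) * t ^ 2 / 4 * mgf f μ t := by ring
  -- back to `g = f − m`
  rw [hred, hmgf]
  have hexp2 : Real.exp (-(t / 2 * m)) ^ 2 = Real.exp (-(t * m)) := by rw [sq, ← Real.exp_add]; ring_nf
  rw [hexp2]
  calc Real.exp (-(t * m)) * variance (fun U => Real.exp (t / 2 * f U)) μ
      ≤ Real.exp (-(t * m)) * ((2 * A * ∑ x ∈ Δ, δ x ^ 2) * t ^ 2 / 4 * mgf f μ t) := mul_le_mul_of_nonneg_left hVF (Real.exp_pos _).le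
    _ = (2 * A * ∑ x ∈ Δ, δ x ^ 2) * t ^ 2 / 4 * (Real.exp (-(t * m)) * mgf f μ t) := by ring

/-- ★★★ **EXPONENTIAL CONCENTRATION IN A GIBBS STATE, upper tail**: under a heat-bath Poincaré inequality of the Gibbs state `μ` for the exponentials `e^{c f}`
through the one-site kernels `γ_{x}`, `x ∈ Δ`, with constant `A > 0`, and per-site oscillations `|f(U) − f(U[x ↦ s])| ≤ δ_x` (`∑_{x∈Δ} δ_x² > 0`), a bounded measurable
`f` satisfies `μ{f − E_μ f ≥ r} ≤ e^{2/3} exp(−r / √(2A ∑_{x∈Δ} δ_x²))` for every `r`. [folklore] -/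
theorem gibbs_measureReal_deviation_ge_le (hγ : IsSpecification γ) {μ : Measure (ι → S)} (hμ : IsGibbsMeasure γ μ) {Δ : Finset ι} {A : ℝ} (hA : 0 < A)
    {f : (ι → S) → ℝ} (hf : Measurable f) {M : ℝ} (hM : ∀ U, |f U| ≤ M)
    (hP : ∀ c : ℝ, variance (fun U => Real.exp (c * f U)) μ ≤
      A * ∑ x ∈ Δ, ∫ U, ∫ σ, (Real.exp (c * f U) - Real.exp (c * f σ)) ^ 2 ∂(γ {x} U) ∂μ)
    (δ : ι → ℝ) (hδ : ∀ x ∈ Δ, ∀ U s, |f U - f (update U x s)| ≤ δ x) (hD : 0 < ∑ x ∈ Δ, δ x ^ 2) (r : ℝ) :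
    μ.real {U | r ≤ f U - ∫ U', f U' ∂μ} ≤ Real.exp (2 / 3) * Real.exp (-r / Real.sqrt (2 * A * ∑ x ∈ Δ, δ x ^ 2)) := by
  haveI := hμ.isProbabilityMeasure
  set m : ℝ := ∫ U', f U' ∂μ with hm
  set g : (ι → S) → ℝ := fun U => f U - m with hg
  have hgm : Measurable g := hf.sub measurable_const
  have hgb : ∀ U, |g U| ≤ M + |m| := fun U => (abs_sub _ _).trans (add_le_add (hM U) le_rfl)
  have hmean : ∫ U, g U ∂μ = 0 := by
    simp only [hg]
    rw [integral_sub (HeatBath.integrable_of_abs_le hf hM) (integrable_const _), integral_const, probReal_univ, one_smul, ← hm, sub_self]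
  have hκ : 0 < 2 * A * ∑ x ∈ Δ, δ x ^ 2 := by positivity
  have hvar : ∀ t : ℝ, 0 ≤ t → variance (fun U => Real.exp (t / 2 * g U)) μ ≤ (2 * A * ∑ x ∈ Δ, δ x ^ 2) * t ^ 2 / 4 * mgf g μ t :=
    fun t _ => gibbs_variance_exp_half_le hγ hμ hA.le hf hM hP δ hδ t
  exact measureReal_ge_le_of_variance_exp_le μ hgm hgb hmean hκ hvar r

/-- ★★★ **EXPONENTIAL CONCENTRATION IN A GIBBS STATE, lower tail**: `μ{f − E_μ f ≤ −r} ≤ e^{2/3} exp(−r / √(2A ∑_{x∈Δ} δ_x²))`. [folklore] -/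
theorem gibbs_measureReal_deviation_le_le (hγ : IsSpecification γ) {μ : Measure (ι → S)} (hμ : IsGibbsMeasure γ μ) {Δ : Finset ι} {A : ℝ} (hA : 0 < A)
    {f : (ι → S) → ℝ} (hf : Measurable f) {M : ℝ} (hM : ∀ U, |f U| ≤ M)
    (hP : ∀ c : ℝ, variance (fun U => Real.exp (c * f U)) μ ≤
      A * ∑ x ∈ Δ, ∫ U, ∫ σ, (Real.exp (c * f U) - Real.exp (c * f σ)) ^ 2 ∂(γ {x} U) ∂μ)
    (δ : ι → ℝ) (hδ : ∀ x ∈ Δ, ∀ U s, |f U - f (update U x s)| ≤ δ x) (hD : 0 < ∑ x ∈ Δ, δ x ^ 2) (r : ℝ) :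
    μ.real {U | f U - ∫ U', f U' ∂μ ≤ -r} ≤ Real.exp (2 / 3) * Real.exp (-r / Real.sqrt (2 * A * ∑ x ∈ Δ, δ x ^ 2)) := by
  haveI := hμ.isProbabilityMeasure
  have hnm : Measurable fun U => -f U := hf.neg
  have hnb : ∀ U, |(-f U)| ≤ M := fun U => by rw [abs_neg]; exact hM U
  have hnδ : ∀ x ∈ Δ, ∀ U s, |(-f U) - (-f (update U x s))| ≤ δ x := fun x hx U s => by
    rw [← abs_neg]
    convert hδ x hx U s using 2
    ring
  have hnP : ∀ c : ℝ, variance (fun U => Real.exp (c * (-f U))) μ ≤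
      A * ∑ x ∈ Δ, ∫ U, ∫ σ, (Real.exp (c * (-f U)) - Real.exp (c * (-f σ))) ^ 2 ∂(γ {x} U) ∂μ := fun c => by
    have h := hP (-c)
    simp only [neg_mul] at h
    simp only [mul_neg]
    exact h
  have h := gibbs_measureReal_deviation_ge_le hγ hμ hA hnm hnb hnP δ hnδ hD r
  have hset : {U | r ≤ -f U - ∫ U', -f U' ∂μ} = {U | f U - ∫ U', f U' ∂μ ≤ -r} := by
    ext U
    simp only [Set.mem_setOf_eq, integral_neg]
    constructor <;> intro hU <;> linarith
  rw [hset] at h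
  exact h

end GibbsState

/-! ### Exponentials of Lipschitz cylinder observables -/

section Cylinder

variable {d N : ℕ}

/-- **`U ↦ e^{c F(U)}` is a Lipschitz cylinder observable if `F` is one**: clamp a Lipschitz representative `f` of `F` to `[−M, M]` (`M = |F 1| + 2K ≥ |F|`) and compose
with `exp ∘ (c ·)`, Lipschitz on `[−|c|M, |c|M]`. [folklore] -/
theorem isLipschitzCylinder_exp_mul {F : LGConfig d (Matrix.specialUnitaryGroup (Fin N) ℂ) → ℝ} {Δ : Finset (ZdEdge d)} {K : ℝ≥0}
    (hF : IsLipschitzCylinder (fundamentalRep (Fin N)) F Δ K) (c : ℝ) :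
    ∃ K' : ℝ≥0, IsLipschitzCylinder (fundamentalRep (Fin N)) (fun U => Real.exp (c * F U)) Δ K' := by
  have hM : ∀ U, |F U| ≤ |F 1| + 2 * K := hF.abs_le
  set M : ℝ := |F 1| + 2 * K with hMdef
  have hM0 : 0 ≤ M := (abs_nonneg _).trans (hM 1)
  obtain ⟨f, hf, hFf⟩ := hF
  -- clamp, scale, exponentiate
  set cl : ℝ → ℝ := fun t => max (-M) (min M t) with hcl
  have hcl1 : LipschitzWith 1 cl := (LipschitzWith.id.const_min M).const_max (-M)
  have hclI : ∀ t, cl t ∈ Set.Icc (-M) M := fun t => ⟨le_max_left _ _, max_le (by linarith) (min_le_left _ _)⟩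
  have hcl_id : ∀ t, |t| ≤ M → cl t = t := fun t ht => by
    rw [hcl]; dsimp only
    rw [min_eq_right (abs_le.1 ht).2, max_eq_right (abs_le.1 ht).1]
  -- `exp ∘ (c ·)` is Lipschitz on `[−M, M]`
  have hexp : LipschitzOnWith ⟨|c| * Real.exp (|c| * M), by positivity⟩ (fun t => Real.exp (c * t)) (Set.Icc (-M) M) := by
    refine LipschitzOnWith.of_dist_le_mul fun a ha b hb => ?_
    rw [Real.dist_eq, Real.dist_eq]
    -- mean value: `|e^{ca} − e^{cb}| ≤ |c| e^{|c|M} |a − b|` on the interval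
    have key : ∀ {x y : ℝ}, x ∈ Set.Icc (-M) M → y ∈ Set.Icc (-M) M → Real.exp (c * x) - Real.exp (c * y) ≤ |c| * Real.exp (|c| * M) * |x - y| := by
      intro x y hx hy
      have h1 : Real.exp (c * x) - Real.exp (c * y) ≤ (c * x - c * y) * Real.exp (c * x) := by
        have h := Real.add_one_le_exp (c * y - c * x)
        have h' : Real.exp (c * y) = Real.exp (c * x) * Real.exp (c * y - c * x) := by rw [← Real.exp_add]; ring_nf
        rw [h']; nlinarith [Real.exp_pos (c * x), Real.exp_pos (c * y - c * x)]
      have h2 : (c * x - c * y) * Real.exp (c * x) ≤ |c| * Real.exp (|c| * M) * |x - y| := by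
        have hcx : Real.exp (c * x) ≤ Real.exp (|c| * M) := Real.exp_le_exp.2 (by
          calc c * x ≤ |c * x| := le_abs_self _
            _ = |c| * |x| := abs_mul _ _
            _ ≤ |c| * M := mul_le_mul_of_nonneg_left (abs_le.2 ⟨by linarith [hx.1], hx.2⟩) (abs_nonneg _))
        calc (c * x - c * y) * Real.exp (c * x) ≤ |c * x - c * y| * Real.exp (c * x) :=
              mul_le_mul_of_nonneg_right (le_abs_self _) (Real.exp_pos _).le
          _ = |c| * |x - y| * Real.exp (c * x) := by rw [← mul_sub, abs_mul]
          _ ≤ |c| * |x - y| * Real.exp (|c| * M) := mul_le_mul_of_nonneg_left hcx (by positivity)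
          _ = |c| * Real.exp (|c| * M) * |x - y| := by ring
      exact h1.trans h2
    have hab := key ha hb
    have hba := key hb ha
    rw [abs_sub_comm b a] at hba
    show |Real.exp (c * a) - Real.exp (c * b)| ≤ (|c| * Real.exp (|c| * M)) * |a - b|
    exact abs_sub_le_iff.2 ⟨by linarith, by linarith⟩
  have hcomp : LipschitzWith (⟨|c| * Real.exp (|c| * M), by positivity⟩ * (1 * K)) (fun m => Real.exp (c * cl (f m))) := by
    have h : LipschitzOnWith _ (fun m => Real.exp (c * cl (f m))) Set.univ := hexp.comp ((hcl1.comp hf).lipschitzOnWith) (fun m _ => hclI _)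
    exact lipschitzOnWith_univ.1 h
  refine ⟨_, fun m => Real.exp (c * cl (f m)), hcomp, fun U => ?_⟩
  show Real.exp (c * F U) = Real.exp (c * cl (f fun e i j => (fundamentalRep (Fin N)) (U e) i j))
  rw [← hFf U, hcl_id _ (hM U)]

end Cylinder

/-! ### The Wilson specification on the Kantorovich–Rubinstein window -/

section Wilson

variable {d N : ℕ}

/-- ★★★ **EXPONENTIAL CONCENTRATION OF LOCAL OBSERVABLES IN EVERY INFINITE-VOLUME GIBBS STATE** (`SU(N)` lattice Yang–Mills on `ℤ^d`, 't Hooft `β`, bare `Nβ`):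
if `2(d−1)|β| ≤ R`, `OneLinkKRModulus N R K` (`K ≥ 0`) and `6(d−1)|β|K ≤ c < 1`, then for EVERY DLR state `μ`, every Lipschitz cylinder `F` on the links `Δ` with link
oscillations `|F(U) − F(U[x ↦ s])| ≤ δ_x` (`∑_{x∈Δ} δ_x² > 0`) and every `r`: `μ{F − E_μ F ≥ r} ≤ e^{2/3} exp(−r / √(2(2(1 − c))⁻¹ ∑_{x∈Δ} δ_x²))`. [folklore] -/
theorem gibbs_measureReal_deviation_ge_le_of_oneLinkKRModulus (hd : 1 ≤ d) (hN : 1 ≤ N) {β R K c : ℝ} (hK : 0 ≤ K)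
    (hR : |β| * (2 * ((d : ℝ) - 1)) ≤ R) (hmod : OneLinkKRModulus N R K) (hc : 6 * ((d : ℝ) - 1) * |β| * K ≤ c) (hc1 : c < 1)
    {μ : Measure (LGConfig d (Matrix.specialUnitaryGroup (Fin N) ℂ))}
    (hμ : μ ∈ ymGibbsMeasures (d := d) (fundamentalRep (Fin N)) (N * β))
    {F : LGConfig d (Matrix.specialUnitaryGroup (Fin N) ℂ) → ℝ} {Δ : Finset (ZdEdge d)} {KF : ℝ≥0}
    (hF : IsLipschitzCylinder (fundamentalRep (Fin N)) F Δ KF) (δ : ZdEdge d → ℝ)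
    (hδ : ∀ x ∈ Δ, ∀ U s, |F U - F (update U x s)| ≤ δ x) (hD : 0 < ∑ x ∈ Δ, δ x ^ 2) (r : ℝ) :
    μ.real {U | r ≤ F U - ∫ U', F U' ∂μ} ≤
      Real.exp (2 / 3) * Real.exp (-r / Real.sqrt (2 * (2 * (1 - c))⁻¹ * ∑ x ∈ Δ, δ x ^ 2)) := by
  classical
  haveI : SecondCountableTopology (Matrix (Fin N) (Fin N) ℂ) := inferInstanceAs (SecondCountableTopology (Fin N → Fin N → ℂ))
  haveI : SecondCountableTopology (Matrix.specialUnitaryGroup (Fin N) ℂ) := Topology.IsEmbedding.subtypeVal.secondCountableTopology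
  have hγ : IsSpecification (ymSpecification (d := d) (fundamentalRep (Fin N)) (N * β)) :=
    isSpecification_ymSpecification_of_t2Space _ (continuous_fundamentalRep (Fin N)) _
  have hμ' : IsGibbsMeasure (ymSpecification (d := d) (fundamentalRep (Fin N)) (N * β)) μ := hμ
  have hP : ∀ c' : ℝ, variance (fun U => Real.exp (c' * F U)) μ ≤ (2 * (1 - c))⁻¹ *
      ∑ x ∈ Δ, ∫ U, ∫ σ, (Real.exp (c' * F U) - Real.exp (c' * F σ)) ^ 2 ∂(ymSpecification (fundamentalRep (Fin N)) (N * β) {x} U) ∂μ := by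
    intro c'
    obtain ⟨K', hK'⟩ := isLipschitzCylinder_exp_mul hF c'
    exact HeatBathPoincareZd.gibbsVariance_le_of_oneLinkKRModulus hd hN hK hR hmod hc hc1 hμ hK'
  exact gibbs_measureReal_deviation_ge_le hγ hμ' (inv_pos.2 (by linarith)) hF.measurable hF.abs_le hP δ hδ hD r

/-- ★★★ **Lower tail, every `SU(N)`, KR window**: `μ{F − E_μ F ≤ −r} ≤ e^{2/3} exp(−r / √(2(2(1 − c))⁻¹ ∑_{x∈Δ} δ_x²))` for every DLR state. [folklore] -/
theorem gibbs_measureReal_deviation_le_le_of_oneLinkKRModulus (hd : 1 ≤ d) (hN : 1 ≤ N) {β R K c : ℝ} (hK : 0 ≤ K)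
    (hR : |β| * (2 * ((d : ℝ) - 1)) ≤ R) (hmod : OneLinkKRModulus N R K) (hc : 6 * ((d : ℝ) - 1) * |β| * K ≤ c) (hc1 : c < 1)
    {μ : Measure (LGConfig d (Matrix.specialUnitaryGroup (Fin N) ℂ))}
    (hμ : μ ∈ ymGibbsMeasures (d := d) (fundamentalRep (Fin N)) (N * β))
    {F : LGConfig d (Matrix.specialUnitaryGroup (Fin N) ℂ) → ℝ} {Δ : Finset (ZdEdge d)} {KF : ℝ≥0}
    (hF : IsLipschitzCylinder (fundamentalRep (Fin N)) F Δ KF) (δ : ZdEdge d → ℝ)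
    (hδ : ∀ x ∈ Δ, ∀ U s, |F U - F (update U x s)| ≤ δ x) (hD : 0 < ∑ x ∈ Δ, δ x ^ 2) (r : ℝ) :
    μ.real {U | F U - ∫ U', F U' ∂μ ≤ -r} ≤
      Real.exp (2 / 3) * Real.exp (-r / Real.sqrt (2 * (2 * (1 - c))⁻¹ * ∑ x ∈ Δ, δ x ^ 2)) := by
  classical
  haveI : SecondCountableTopology (Matrix (Fin N) (Fin N) ℂ) := inferInstanceAs (SecondCountableTopology (Fin N → Fin N → ℂ))
  haveI : SecondCountableTopology (Matrix.specialUnitaryGroup (Fin N) ℂ) := Topology.IsEmbedding.subtypeVal.secondCountableTopology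
  have hγ : IsSpecification (ymSpecification (d := d) (fundamentalRep (Fin N)) (N * β)) :=
    isSpecification_ymSpecification_of_t2Space _ (continuous_fundamentalRep (Fin N)) _
  have hμ' : IsGibbsMeasure (ymSpecification (d := d) (fundamentalRep (Fin N)) (N * β)) μ := hμ
  have hP : ∀ c' : ℝ, variance (fun U => Real.exp (c' * F U)) μ ≤ (2 * (1 - c))⁻¹ *
      ∑ x ∈ Δ, ∫ U, ∫ σ, (Real.exp (c' * F U) - Real.exp (c' * F σ)) ^ 2 ∂(ymSpecification (fundamentalRep (Fin N)) (N * β) {x} U) ∂μ := by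
    intro c'
    obtain ⟨K', hK'⟩ := isLipschitzCylinder_exp_mul hF c'
    exact HeatBathPoincareZd.gibbsVariance_le_of_oneLinkKRModulus hd hN hK hR hmod hc hc1 hμ hK'
  exact gibbs_measureReal_deviation_le_le hγ hμ' (inv_pos.2 (by linarith)) hF.measurable hF.abs_le hP δ hδ hD r

/-- ★★★ **`SU(2)`, `d = 4`, HYPOTHESIS-FREE on `0 ≤ β_W < 2/9`** (tree coupling `β_W/2`, quarter modulus): for EVERY DLR state `μ` of 4D `SU(2)` lattice Yang–Mills,
every Lipschitz cylinder `F` on the links `Δ` with `|F(U) − F(U[x ↦ s])| ≤ δ_x` (`∑ δ_x² > 0`) and every `r`: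
`μ{F − E_μ F ≥ r} ≤ e^{2/3} exp(−r / √(2(2 − 9β_W)⁻¹ ∑_{x∈Δ} δ_x²))` — exponential concentration of local observables in the infinite-volume strong-coupling
state, with the heat-bath spectral-gap constant. [folklore] -/
theorem su2_gibbs_measureReal_deviation_ge_le {βW : ℝ} (h0 : 0 ≤ βW) (h : βW < 2 / 9)
    {μ : Measure (LGConfig 4 (Matrix.specialUnitaryGroup (Fin 2) ℂ))}
    (hμ : μ ∈ ymGibbsMeasures (d := 4) (fundamentalRep (Fin 2)) (βW / 2))
    {F : LGConfig 4 (Matrix.specialUnitaryGroup (Fin 2) ℂ) → ℝ} {Δ : Finset (ZdEdge 4)} {KF : ℝ≥0}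
    (hF : IsLipschitzCylinder (fundamentalRep (Fin 2)) F Δ KF) (δ : ZdEdge 4 → ℝ)
    (hδ : ∀ x ∈ Δ, ∀ U s, |F U - F (update U x s)| ≤ δ x) (hD : 0 < ∑ x ∈ Δ, δ x ^ 2) (r : ℝ) :
    μ.real {U | r ≤ F U - ∫ U', F U' ∂μ} ≤ Real.exp (2 / 3) * Real.exp (-r / Real.sqrt (2 * (2 - 9 * βW)⁻¹ * ∑ x ∈ Δ, δ x ^ 2)) := by
  have hβ : ((2 : ℕ) : ℝ) * (βW / 4) = βW / 2 := by push_cast; ring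
  have habs : |βW / 4| = βW / 4 := abs_of_nonneg (by positivity)
  have hμ4 : μ ∈ ymGibbsMeasures (d := 4) (fundamentalRep (Fin 2)) ((2 : ℕ) * (βW / 4)) := by rwa [hβ]
  have key := gibbs_measureReal_deviation_ge_le_of_oneLinkKRModulus (d := 4) (N := 2) (by norm_num) (by norm_num) (β := βW / 4) (R := 3 * βW / 2)
    zero_le_one (by rw [habs]; norm_num; linarith) (SlabAreaLawDimensions.su2_oneLinkKRModulus_of_le_one (by linarith)) (c := 9 * βW / 2)
    (by rw [habs]; norm_num; linarith) (by linarith) hμ4 hF δ hδ hD r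
  have e : (2 * (1 - 9 * βW / 2))⁻¹ = (2 - 9 * βW)⁻¹ := by congr 1; ring
  rw [e] at key
  exact key

/-- ★★★ **`SU(2)`, `d = 4`, `0 ≤ β_W < 2/9`, lower tail**: `μ{F − E_μ F ≤ −r} ≤ e^{2/3} exp(−r / √(2(2 − 9β_W)⁻¹ ∑_{x∈Δ} δ_x²))` for every DLR state. [folklore] -/
theorem su2_gibbs_measureReal_deviation_le_le {βW : ℝ} (h0 : 0 ≤ βW) (h : βW < 2 / 9)
    {μ : Measure (LGConfig 4 (Matrix.specialUnitaryGroup (Fin 2) ℂ))}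
    (hμ : μ ∈ ymGibbsMeasures (d := 4) (fundamentalRep (Fin 2)) (βW / 2))
    {F : LGConfig 4 (Matrix.specialUnitaryGroup (Fin 2) ℂ) → ℝ} {Δ : Finset (ZdEdge 4)} {KF : ℝ≥0}
    (hF : IsLipschitzCylinder (fundamentalRep (Fin 2)) F Δ KF) (δ : ZdEdge 4 → ℝ)
    (hδ : ∀ x ∈ Δ, ∀ U s, |F U - F (update U x s)| ≤ δ x) (hD : 0 < ∑ x ∈ Δ, δ x ^ 2) (r : ℝ) :
    μ.real {U | F U - ∫ U', F U' ∂μ ≤ -r} ≤ Real.exp (2 / 3) * Real.exp (-r / Real.sqrt (2 * (2 - 9 * βW)⁻¹ * ∑ x ∈ Δ, δ x ^ 2)) := by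
  have hβ : ((2 : ℕ) : ℝ) * (βW / 4) = βW / 2 := by push_cast; ring
  have habs : |βW / 4| = βW / 4 := abs_of_nonneg (by positivity)
  have hμ4 : μ ∈ ymGibbsMeasures (d := 4) (fundamentalRep (Fin 2)) ((2 : ℕ) * (βW / 4)) := by rwa [hβ]
  have key := gibbs_measureReal_deviation_le_le_of_oneLinkKRModulus (d := 4) (N := 2) (by norm_num) (by norm_num) (β := βW / 4) (R := 3 * βW / 2)
    zero_le_one (by rw [habs]; norm_num; linarith) (SlabAreaLawDimensions.su2_oneLinkKRModulus_of_le_one (by linarith)) (c := 9 * βW / 2)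
    (by rw [habs]; norm_num; linarith) (by linarith) hμ4 hF δ hδ hD r
  have e : (2 * (1 - 9 * βW / 2))⁻¹ = (2 - 9 * βW)⁻¹ := by congr 1; ring
  rw [e] at key
  exact key

end Wilson

end Summit.Ventures.YMGap.RobustBall.HeatBathConcentration

end
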